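import Summits.QuantumFields.BalabanUV.Beta.EriceRemainderEnclosureHistoryAutonomyComparisonMarkovCreditPedestal
import Summits.QuantumFields.BalabanUV.Beta.EriceRemainderEnclosureHistoryAutonomyComparisonMarkovCreditSharp

/-!
# EriceRemainderEnclosureHistoryAutonomyComparisonMarkovCreditDichotomy — (E139h) **THE MARKOV CREDIT LAW IS THE EXACT COMPARISON THRESHOLD OF THE PEDESTAL FAMILY
# (`markov_credit_dichotomy`): for `L ≥ 1`, `s > 0`, `M̃ > 0`,   `M̃·(1 − (1+s)^{−L}) ≤ s`   ⟺   for every box, cap `P > 0`, activation level `c > 0`, excess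
# `ε ≥ 0`, pin, and every pair of box solutions `h` (of `B(w) = 1 + s·max(P − 1∕w_0², 0) + M̃·max(c − 1∕w_L², 0)`) and `h′` (of `B + ε`) whose hinge reach lies in the
# pedestal's active range (`1∕h′_m² + L + 1 < c ⟹ 1∕h′_{m+L+1}² ≤ P`), `h′ ≤ h` at every scale.**  ⟹ is (E139g) `le_of_pedestal_hinge`; ⟸ is (E139e)'s construction
# with the window certified down to the row `2L+1` (`exists_violation_markov_credit_reach`), so that the violating orbit is itself reach-compatible.

Cell `pub-balaban`, β-function sub-cell, BINDER row D4 «RemainderConst leaves for Bałaban's split» (`HOME/BINDER-OWNERS.md`; owner lineage `b2b-balaban-beta-an4`;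
this file by co-owner #2 lineage `b2b-balaban-beta-d4-p2`, generation 107), β-FLOW TEAM duty (1), FREEZE (0) honoured (def-free; (E139e) `hh_facts` ∕ `pstep_active` ∕
`window_lower` ∕ `orbit_facts` ∕ `flows_of_orbits`, (E139g) `le_of_pedestal_hinge` ∕ `ph_mono` ∕ `ph_zm`, (E138f) `lhinge_nonneg` ∕ `lhinge_le`, node U2's
`one_div_sq_one_div_sqrt` BY NAME; `exists_window_orbits_gen` repeats (E139e) `exists_window_orbits` with a free window length, nothing else restated).

HONEST FRAMING (page 1, verbatim and binding).  *"Discharging BetaPertH makes Bałaban's UV stability UNCONDITIONAL — a real constructive-QFT result; it is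
NOT the continuum limit and NOT the Clay problem."*  THIS FILE DISCHARGES NOTHING OF THE KIND.  Elementary real analysis about a DISPLAYED abstract functional on a box
]0,γ]^ℕ — a census example, not a fact; nothing about Bałaban's (1.22) limit functional is PRINTED in this form ([I] p. 298; GAPS G-t4-U2-1∕-2) or asserted.  Row D4
class UNCHANGED (critical-path width 0; instance 0∕1; D4 DISCHARGE NO DATE).  NOT B12 Thm 2, NOT BetaPertH, NOT continuum YM, NOT Clay.

WHAT IS PROVED ([folklore]; 0 `def`, 0 sorry).  §1 `exists_window_orbits_gen`, **`exists_violation_markov_credit_reach`**.  §2 **`markov_credit_dichotomy`**.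
-/

noncomputable section
open Finset Set

namespace Summit.QuantumFields.BalabanUV.Beta.EriceRemainderEnclosureHistoryAutonomyComparisonMarkovCreditDichotomy

open Literature.MathematicalPhysics.QuantumFieldTheory.Balaban1983to89
open Literature.MathematicalPhysics.QuantumFieldTheory.Balaban1983to89.T4BetaStationary
open Literature.MathematicalPhysics.QuantumFieldTheory.Balaban1983to89.T4BetaFlowWellPosed
open Summit.QuantumFields.BalabanUV.Beta.EriceRemainderEnclosureHistoryAutonomyComparisonDualContractionSharp (lhinge_nonneg lhinge_le)
open Summit.QuantumFields.BalabanUV.Beta.EriceRemainderEnclosureHistoryAutonomyComparisonMarkovCreditSharp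
  (hh_facts pstep_active window_lower orbit_facts flows_of_orbits)
open Summit.QuantumFields.BalabanUV.Beta.EriceRemainderEnclosureHistoryAutonomyComparisonMarkovCreditPedestal (le_of_pedestal_hinge ph_mono ph_zm)

/-! ## §1 The violating orbit with a longer window -/

/-- (E139e) `exists_window_orbits` with a free window length `N`: the cap `P = 1 + (1+s)^{N+1}(N+2)(2+s+M̃)` keeps both orbits `≥ 2 + s + M̃` below it up to the row
`N+1`. [folklore] -/
theorem exists_window_orbits_gen {L : ℕ} (N : ℕ) {s Mt : ℝ} (hs : 0 < s) (hMt : 0 < Mt) (hviol : s < Mt * (1 - ((1 + s)⁻¹) ^ L)) :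
    ∃ (P Hh A1 : ℝ) (a' ah : ℕ → ℝ), 0 < P ∧ 0 ≤ Hh ∧ s < Hh ∧ Mt * (1 - ((1 + s)⁻¹) ^ (L + 1) * (1 + Hh)) = Hh ∧
      a' 0 = 1 ∧ (∀ m, a' (m + 1) = max ((a' m + 1 + s + s * P) / (1 + s)) (a' m + 1 + s)) ∧
      ah 0 = 1 ∧ ah 1 = A1 ∧ (∀ m, 1 ≤ m → ah (m + 1) = max ((ah m + 1 + 0 + s * P) / (1 + s)) (ah m + 1 + 0)) ∧
      A1 = P - (1 + s)⁻¹ * (P - 2 - Hh) ∧ 1 ≤ A1 ∧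
      (∀ m, m ≤ N + 1 → 2 + s + Mt ≤ P - a' m) ∧ (∀ m, m ≤ N + 1 → 2 + s + Mt ≤ P - ah m) := by
  have h1s : 0 < 1 + s := by linarith
  have hr0 : 0 < (1 + s)⁻¹ := inv_pos.mpr h1s
  have hr1 : (1 + s)⁻¹ < 1 := inv_lt_one_of_one_lt₀ (by linarith)
  have hrs : (1 + s)⁻¹ * (1 + s) = 1 := inv_mul_cancel₀ h1s.ne'
  have hρL : ((1 + s)⁻¹) ^ (L + 1) * (1 + s) = ((1 + s)⁻¹) ^ L := by rw [pow_succ, mul_assoc, hrs, mul_one]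
  obtain ⟨hHh0, hHhMt, hfix, hsHh⟩ := hh_facts (s := s) hMt (pow_pos hr0 (L + 1)) (pow_le_one₀ hr0.le hr1.le)
  have hsHh := hsHh (by rw [hρL]; exact hviol)
  obtain ⟨Hh, hHhdef⟩ : ∃ Hh : ℝ, Hh = Mt * (1 - ((1 + s)⁻¹) ^ (L + 1)) / (1 + Mt * ((1 + s)⁻¹) ^ (L + 1)) := ⟨_, rfl⟩
  rw [← hHhdef] at hHh0 hHhMt hsHh
  have hfix' : Mt * (1 - ((1 + s)⁻¹) ^ (L + 1) * (1 + Hh)) = Hh := by rw [hHhdef]; exact hfix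
  have hT0 : 0 ≤ 2 + s + Mt := by positivity
  obtain ⟨D₀, hD₀0, hrD₀, hD₀ge⟩ : ∃ D₀ : ℝ, 0 ≤ D₀ ∧ ((1 + s)⁻¹) ^ (N + 1) * D₀ = ((N : ℝ) + 1) * (2 + s + Mt) + (2 + s + Mt)
      ∧ 2 + s + Mt ≤ D₀ := by
    have hQ0 : 0 ≤ ((N : ℝ) + 1) * (2 + s + Mt) := by positivity
    have hpow1 : 1 ≤ (1 + s) ^ (N + 1) := one_le_pow₀ (by linarith)
    refine ⟨(1 + s) ^ (N + 1) * (((N : ℝ) + 1) * (2 + s + Mt) + (2 + s + Mt)), by positivity, ?_, by nlinarith⟩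
    rw [← mul_assoc, ← mul_pow, hrs, one_pow, one_mul]
  obtain ⟨P, hP⟩ : ∃ P : ℝ, P = 1 + D₀ := ⟨_, rfl⟩
  have hP0 : 0 < P := by rw [hP]; linarith
  obtain ⟨a', ha'0, ha'S⟩ : ∃ a' : ℕ → ℝ, a' 0 = 1 ∧ ∀ m, a' (m + 1) = max ((a' m + 1 + s + s * P) / (1 + s)) (a' m + 1 + s) :=
    ⟨fun m => Nat.rec (motive := fun _ => ℝ) 1 (fun _ x => max ((x + 1 + s + s * P) / (1 + s)) (x + 1 + s)) m, rfl, fun m => rfl⟩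
  obtain ⟨A1, hA1⟩ : ∃ A1 : ℝ, A1 = P - (1 + s)⁻¹ * (P - 2 - Hh) := ⟨_, rfl⟩
  obtain ⟨ah, hah0, hah1, hahS⟩ : ∃ ah : ℕ → ℝ, ah 0 = 1 ∧ ah 1 = A1 ∧
      ∀ m, 1 ≤ m → ah (m + 1) = max ((ah m + 1 + 0 + s * P) / (1 + s)) (ah m + 1 + 0) := by
    refine ⟨fun m => Nat.rec (motive := fun _ => ℝ) 1
        (fun n x => Nat.rec (motive := fun _ => ℝ) A1 (fun _ _ => max ((x + 1 + 0 + s * P) / (1 + s)) (x + 1 + 0)) n) m,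
      rfl, rfl, fun m hm => ?_⟩
    cases m with
    | zero => exact absurd hm (by norm_num)
    | succ k => rfl
  have hA1ge : 1 ≤ A1 := by
    have : (1 + s)⁻¹ * (P - 2 - Hh) ≤ P - 2 - Hh := mul_le_of_le_one_left (by rw [hP]; linarith) hr1.le
    rw [hA1]; linarith
  have hwin' := window_lower (D := fun m => P - a' m) (ϑ := 2 + s + Mt) (T := 2 + s + Mt) (L := N) hr0.le hr1.le hT0
    (show P - a' 0 = D₀ by rw [ha'0, hP]; ring) hD₀0
    (fun m _ hθ => by
      have hθ' : 2 + s + Mt ≤ P - a' m := hθ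
      show (1 + s)⁻¹ * (P - a' m) - (2 + s + Mt) ≤ P - a' (m + 1)
      rw [ha'S, pstep_active hs (by linarith), div_eq_inv_mul]
      nlinarith [hrs])
    (by rw [hrD₀]; linarith)
  have hwinh := window_lower (D := fun m => P - ah m) (ϑ := 2 + s + Mt) (T := 2 + s + Mt) (L := N) hr0.le hr1.le hT0
    (show P - ah 0 = D₀ by rw [hah0, hP]; ring) hD₀0
    (fun m _ hθ => by
      have hθ' : 2 + s + Mt ≤ P - ah m := hθ
      show (1 + s)⁻¹ * (P - ah m) - (2 + s + Mt) ≤ P - ah (m + 1)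
      rcases Nat.eq_zero_or_pos m with h0 | hpos
      · subst h0
        rw [show ah (0 + 1) = ah 1 from rfl, hah1, hA1, hah0]
        have : (1 + s)⁻¹ * (1 + Hh) ≤ 1 + Hh := mul_le_of_le_one_left (by linarith) hr1.le
        nlinarith
      · rw [hahS m hpos, pstep_active hs (by linarith), div_eq_inv_mul]
        nlinarith [hrs])
    (by rw [hrD₀]; linarith)
  exact ⟨P, Hh, A1, a', ah, hP0, hHh0, hsHh, hfix', ha'0, ha'S, hah0, hah1, hahS, hA1, hA1ge,
    fun m hm => (hwin' m hm).2, fun m hm => (hwinh m hm).2⟩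

/-- **THE VIOLATING ORBIT IS REACH-COMPATIBLE.**  (E139e) `exists_violation_markov_credit` with the window certified down to the row `2L+1`: for `M̃(1 − (1+s)^{−L}) > s`
the pedestal hinge and its translate by `s` have box solutions from the pin `1` with `h 1 < h′ 1`, AND the hinge reach of `h′` lies in the pedestal's active range
(`1∕h′_m² + L + 1 < c ⟹ 1∕h′_{m+L+1}² ≤ P`: such rows have `m ≤ L`, since `c = 1∕h′_{L+1}²`). [folklore] -/
theorem exists_violation_markov_credit_reach {L : ℕ} (hL : 1 ≤ L) {s Mt : ℝ} (hs : 0 < s) (hMt : 0 < Mt)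
    (hviol : s < Mt * (1 - ((1 + s)⁻¹) ^ L)) :
    ∃ (P c : ℝ) (h h' : ℕ → ℝ), 0 < P ∧ 0 < c ∧
      SeqBox 1 h ∧ MemFlow (fun w : ℕ → ℝ => 1 + s * max (P - 1 / w 0 ^ 2) 0 + Mt * max (c - 1 / w L ^ 2) 0) 1 h ∧
      SeqBox 1 h' ∧ MemFlow (fun w : ℕ → ℝ => (1 + s * max (P - 1 / w 0 ^ 2) 0 + Mt * max (c - 1 / w L ^ 2) 0) + s) 1 h' ∧
      (∀ m : ℕ, 1 / h' m ^ 2 + ((L : ℝ) + 1) < c → 1 / h' (m + (L + 1)) ^ 2 ≤ P) ∧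
      h 1 < h' 1 := by
  have h1s : 0 < 1 + s := by linarith
  obtain ⟨P, Hh, A1, a', ah, hP0, hHh0, hsHh, hfix, ha'0, ha'S, hah0, hah1, hahS, hA1, hA1ge, hw', hwh⟩ :=
    exists_window_orbits_gen (L := L) (2 * L) hs hMt hviol
  obtain ⟨ha'mono, hahmono, ha'1, hah1le, hahstep, hlead1, hread, hread0, hread1⟩ :=
    orbit_facts (L := L) hs hMt hHh0 ha'0 ha'S hah0 hah1 hahS hA1 hA1ge
      (fun m hm => by linarith [hw' m (by omega)]) (fun m hm => by linarith [hwh m (by omega)]) hfix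
  have hPA : 0 ≤ P - A1 := by have := hwh 1 (by omega); rw [hah1] at this; linarith
  obtain ⟨hboxh, hflowh, hbox', hflow'⟩ :=
    flows_of_orbits (L := L) (Mt := Mt) hs ha'0 ha'S hah0 hah1 hahS hA1 hPA ha'mono hahmono ha'1 hah1le hahstep hread hread0 hread1
  have hc0 : 0 < a' (L + 1) := by linarith [ha'1 (L + 1)]
  refine ⟨P, a' (L + 1), fun j => 1 / Real.sqrt (ah j), fun j => 1 / Real.sqrt (a' j), hP0, hc0, hboxh, hflowh, hbox', hflow', ?_, ?_⟩
  · -- the reach: rows with a′_m + L + 1 < c = a′_{L+1} have m ≤ L, and the window covers the row m + L + 1 ≤ 2L + 1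
    intro m hlt
    rw [one_div_sq_one_div_sqrt (by linarith [ha'1 m])] at hlt
    rw [one_div_sq_one_div_sqrt (by linarith [ha'1 (m + (L + 1))])]
    have hmL : m ≤ L := by
      by_contra hgt
      have hge : a' (L + 1) ≤ a' m := ha'mono (by omega)
      have : (0 : ℝ) ≤ L := Nat.cast_nonneg L
      linarith
    linarith [hw' (m + (L + 1)) (by omega)]
  · have hlt : a' 1 < ah 1 := by
      have : 1 < (1 + s)⁻¹ * (1 + Hh) := by rw [← div_eq_inv_mul, one_lt_div h1s]; linarith
      linarith
    have hpos' : 0 < a' 1 := by linarith [ha'1 1]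
    exact one_div_lt_one_div_of_lt (Real.sqrt_pos.mpr hpos') (Real.sqrt_lt_sqrt hpos'.le hlt)

/-! ## §2 The dichotomy -/

/-- **THE MARKOV CREDIT LAW IS THE EXACT COMPARISON THRESHOLD OF THE PEDESTAL FAMILY.**  `L ≥ 1`, `s > 0`, `M̃ > 0`.  Then `M̃·(1 − (1+s)^{−L}) ≤ s` holds IF AND ONLY
IF: for every box `]0,γ]`, cap `P > 0`, activation level `c > 0`, excess `ε ≥ 0`, pin `p ∈ ]0,γ]`, and all box solutions `h` of the pedestal hinge
`B(w) = 1 + s·max(P − 1∕w_0², 0) + M̃·max(c − 1∕w_L², 0)` and `h′` of `B + ε` from `p` whose hinge reach lies in the pedestal's active range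
(`1∕h′_m² + L + 1 < c ⟹ 1∕h′_{m+L+1}² ≤ P`), `h′ ≤ h` at every scale.  (⟹ (E139g) `le_of_pedestal_hinge`, an instance of (E139f); ⟸ `exists_violation_markov_credit_reach`,
(E139e)'s construction; `M̃·Σ_{j=1}^{L}(1+s)^{−j} = M̃(1 − (1+s)^{−L})∕s` is (E139b)'s row quantity; `s → 0`: (E56a) ∕ (E138d)'s `L·M̃ ≤ 1`.) [folklore] -/
theorem markov_credit_dichotomy {L : ℕ} (hL : 1 ≤ L) {s Mt : ℝ} (hs : 0 < s) (hMt : 0 < Mt) :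
    Mt * (1 - ((1 + s)⁻¹) ^ L) ≤ s ↔
      ∀ (γ P c ε p : ℝ) (h h' : ℕ → ℝ), 0 < P → 0 < c → 0 ≤ ε → 0 < p → p ≤ γ →
        SeqBox γ h → MemFlow (fun w : ℕ → ℝ => 1 + s * max (P - 1 / w 0 ^ 2) 0 + Mt * max (c - 1 / w L ^ 2) 0) p h →
        SeqBox γ h' → MemFlow (fun w : ℕ → ℝ => (1 + s * max (P - 1 / w 0 ^ 2) 0 + Mt * max (c - 1 / w L ^ 2) 0) + ε) p h' →
        (∀ m : ℕ, 1 / h' m ^ 2 + ((L : ℝ) + 1) < c → 1 / h' (m + (L + 1)) ^ 2 ≤ P) →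
        ∀ j, h' j ≤ h j := by
  constructor
  · intro hlaw γ P c ε p h h' hP hc hε hp hpγ hh hf hh' hf' hreach j
    exact le_of_pedestal_hinge hs hMt.le hL hP hc hε hlaw hp hpγ hh hf hh' hf' hreach j
  · intro hall
    by_contra hgt
    have hviol : s < Mt * (1 - ((1 + s)⁻¹) ^ L) := lt_of_not_ge hgt
    obtain ⟨P, c, h, h', hP, hc, hh, hf, hh', hf', hreach, hlt⟩ := exists_violation_markov_credit_reach hL hs hMt hviol
    have hle := hall 1 P c s 1 h h' hP hc hs.le one_pos le_rfl hh hf hh' hf' hreach 1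
    linarith

end Summit.QuantumFields.BalabanUV.Beta.EriceRemainderEnclosureHistoryAutonomyComparisonMarkovCreditDichotomy

end
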